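import Summits.CriticalPhenomena.PercolationContinuityZ3.Theorems.PercNearOneGluingNoHeavyQuantShapePieceBlob
import Summits.CriticalPhenomena.PercolationContinuityZ3.Theorems.PercNearOneGluingNoHeavyQuantPieceBlobLongBricks
import Summits.CriticalPhenomena.PercolationContinuityZ3.Theorems.PercNearOneGluingNoHeavyQuantPieceBlobLongDerivedCap
import Summits.CriticalPhenomena.PercolationContinuityZ3.Theorems.PercNearOneGluingNoHeavyQuantPieceBlobLongDerivedCost
import HarnessLib

/-!
# QUANT lane R8, T-DEC: THE PIECE BESIDE A BIG BLOB FOR EVERY SHAPE `lo < K ≤ 4lo` AND EVERY GATE — the per-gate ROUTE of the two-absorber greedy rule (census-1 gen 33)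

builds on p205010 (kernel theorem, internal audit signed; external expert review pending)

Support file (`--supports stmt-CriticalPhenomena-4575`), QUANT lane seat prim-quant-census-1 (gen 33); memo
`run/shared/lean/prim/quant/prim-quant-census-1/g33/WIDE3-G33.md` §4.  Theorems only, standard axioms, no sorries.  This file: **`pieceBlobLong_route`** (flows `f₁`, `f₂` of the low atom with compatibility, capacity and joint torque cost).
THE RULE (memo §4; exact regression `g33/code/exp6_pieceblob_rule.py`, 0 failures on 13 shapes `lo < K ≤ 4lo`): per outer gate, the low atom `lo` of
`S(γ) ∗ blob_{lo+K}(g)` goes to `2lo+K` while `θ₁(ν(lo)+ν(2lo+K)) ≤ ν(2lo+K)` (`θ₁ = max(y, D/(lo+K))`, `D = T − 2lo`); otherwise the flow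
SPLITS — `a(1−γ)g(lo+K−D)/D` saturates `2lo+K`, the overflow `a(1−γ)(D−(lo+K)g)/D` goes to the top; for `D ≥ lo+K` everything goes to the top.
Bricks (polynomial inequalities in `lo, K, γ, g, D` (and `y`/`x`), K-units `c = lo/K ∈ [1/4, 1]` split into the boxes `[1/4,1/3]`, `[1/3,1/2]`, `[1/2,1]`):
PB1/PB2 (top capacity of the overflow: ρ / floor), PC1a–c / PC2a–c (split cost: ρ / floor regime, three budget sub-cases), PD1/PD2 (top capacity,
regime II), PE1/PE2 (top cost, regime II); the floor-regime bricks are certified at the floor bound `ȳ = (2lo+D)·x_max/T₀` (`…GD` / `…XD` for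
`x_max = g` / `(lo+Kγ)/(lo+K)`) and transported to every `y ≤ ȳ` by monotonicity (`pb_glue_cap`, `pb_glue_cost`).  Certificates: Handelman products found
by kit (`g33/code/kitjob6`: scipy/HiGHS dual simplex for the support + exact rational repair), checked here by `linarith`.

HONEST STATUS.  Route bookkeeping; the SDEC theorem is `…PieceBlobLongHub`.  `SiblingStep`, `GluedDominatedMass`, `SDECConvClosed`, `FarTreeRow` OPEN; RATE class (log\*) / honest sentence of
`run/shared/lean/prim/quant/README.md` unchanged.  [this work].  Nothing here is cited as a published result.  The gluing rows served
[cite: KozmaNitzan2024, Conjecture 3 (p. 15)]; product measure [cite: Grimmett1999, §1.3 p. 10].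
-/

noncomputable section

open scoped BigOperators

namespace Summit.CriticalPhenomena.PercolationContinuityZ3.Theorems
namespace Quant
namespace LawDec

/-! ### The two-absorber greedy route of the piece beside the blob -/

set_option maxHeartbeats 4000000 in
/-- **the two-absorber greedy route of the piece beside the blob, every shape `lo < K ≤ 4lo`, every gate** (one outer gate; `ν` the gated law with masses
`a(1−γ)(1−g), aγ(1−g), a(1−γ)g, aγg` at `lo, lo+K, 2lo+K, 2lo+2K`, `y = ax`, `T = aT₀ > 2lo`, `D = T − 2lo`): flows `f₁` (to `2lo+K`: all of the low
while `θ₁(ν(lo)+ν(2lo+K)) ≤ ν(2lo+K)`, `θ₁ = max(y, D/(lo+K))`; the saturating amount `a(1−γ)g(lo+K−D)/D` when that fails; nothing once `D ≥ lo+K`) and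
`f₂ = ν(lo) − f₁` (to the top), with their compatibility, capacity and joint torque-cost facts. [this work] -/
theorem pieceBlobLong_route (lo K : ℕ) (hlo : 1 ≤ lo) (hloK : lo < K) (hK4 : K ≤ 4 * lo) (ν : ℕ → ℝ) (y T γ g a x : ℝ) (g0 : ∀ h, 0 ≤ ν h)
    (hx0 : 0 < x) (hxg : x ≤ g) (hxP : x * ((lo : ℝ) + K) ≤ lo + K * γ) (ha0 : 0 < a) (ha1 : a ≤ 1) (hy : y = a * x)
    (hγ : (lo : ℝ) ≤ K * γ) (hγ1 : γ < 1) (hbig : 2 * (lo : ℝ) ≤ ((lo : ℝ) + K) * g) (hg1 : g < 1)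
    (hT : T = a * ((lo : ℝ) + K * γ + ((lo : ℝ) + K) * g)) (hT2 : 2 * (lo : ℝ) < T)
    (v1 : ν lo = a * ((1 - γ) * (1 - g))) (v2 : ν (lo + K) = a * (γ * (1 - g))) (v3 : ν (2 * lo + K) = a * ((1 - γ) * g))
    (v4 : ν (2 * lo + 2 * K) = a * (γ * g)) :
    ∃ f₁ f₂ : ℝ, 0 ≤ f₁ ∧ 0 ≤ f₂ ∧ f₁ + f₂ = ν lo ∧ (0 < f₁ → T < (lo : ℝ) + ((2 * lo + K : ℕ) : ℝ)) ∧
      freeRate y T lo (2 * lo + K) * f₁ ≤ ν (2 * lo + K) ∧ freeRate y T lo (2 * lo + 2 * K) * f₂ ≤ ν (2 * lo + 2 * K) ∧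
      (if T < ((2 * lo + K : ℕ) : ℝ) then (((2 * lo + K : ℕ) : ℝ) - T) * (freeRate y T lo (2 * lo + K) * f₁) else 0)
          + (((2 * lo + 2 * K : ℕ) : ℝ) - T) * (freeRate y T lo (2 * lo + 2 * K) * f₂)
        ≤ ∑ l ∈ Finset.range (2 * lo + 2 * K + 1), (if (1 ≤ l ∧ (l : ℝ) < T) then ν l * (T - l) else 0) := by
  -- scalars
  have hloR : (1 : ℝ) ≤ lo := by exact_mod_cast hlo
  have hlo0 : (0 : ℝ) < lo := by linarith
  have hKR : (lo : ℝ) < K := by exact_mod_cast hloK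
  have hK4R : (K : ℝ) ≤ 4 * lo := by exact_mod_cast hK4
  have hK0 : (0 : ℝ) < K := by linarith
  have hB0 : (0 : ℝ) < (lo : ℝ) + K := by linarith
  have hL0 : (0 : ℝ) < (lo : ℝ) + 2 * K := by linarith
  have pγ : 0 ≤ γ := by
    by_contra hc; push Not at hc; have := mul_neg_of_pos_of_neg hK0 hc; linarith
  have nγ : 0 < 1 - γ := by linarith
  have pg : 0 ≤ g := le_trans hx0.le hxg
  have ng : 0 < 1 - g := by linarith
  have hx1 : x < 1 := lt_of_le_of_lt hxg hg1
  have hyx : y ≤ x := by rw [hy]; have := mul_le_mul_of_nonneg_right ha1 hx0.le; linarith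
  have hy0 : 0 < y := by rw [hy]; exact mul_pos ha0 hx0
  have hy1 : y < 1 := lt_of_le_of_lt hyx hx1
  set T₀ : ℝ := (lo : ℝ) + K * γ + ((lo : ℝ) + K) * g with hT₀
  have hT0p : 0 < T₀ := by have := mul_nonneg hK0.le pγ; have := mul_nonneg hB0.le pg; rw [hT₀]; linarith
  have hTle : T ≤ T₀ := by have := mul_le_mul_of_nonneg_right ha1 hT0p.le; rw [hT]; linarith
  have hTtop : T < 2 * (lo : ℝ) + 2 * K := by
    have h1 : (K : ℝ) * γ < K := by have := mul_lt_mul_of_pos_left hγ1 hK0; linarith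
    have h2 : ((lo : ℝ) + K) * g < lo + K := by have := mul_lt_mul_of_pos_left hg1 hB0; linarith
    rw [hT₀] at hTle; linarith
  set D : ℝ := T - 2 * (lo : ℝ) with hD
  have hD0 : 0 < D := by rw [hD]; linarith
  have hDmax : D ≤ K * γ - lo + ((lo : ℝ) + K) * g := by rw [hD]; rw [hT₀] at hTle; linarith
  have eTD : T = 2 * lo + D := by rw [hD]; ring
  -- the floor bounds in the form of the bricks
  have hyg' : y * T₀ ≤ (2 * lo + D) * g := by
    rw [← eTD, hT, hy]
    have : a * x * T₀ ≤ a * g * T₀ := mul_le_mul_of_nonneg_right (mul_le_mul_of_nonneg_left hxg ha0.le) hT0p.le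
    linarith
  have hyB' : y * T₀ * ((lo : ℝ) + K) ≤ (2 * lo + D) * ((lo : ℝ) + K * γ) := by
    rw [← eTD, hT, hy]
    have : a * T₀ * (x * ((lo : ℝ) + K)) ≤ a * T₀ * ((lo : ℝ) + K * γ) := mul_le_mul_of_nonneg_left hxP (mul_nonneg ha0.le hT0p.le)
    linarith
  rw [hT₀] at hyg' hyB'
  clear_value T₀ D
  -- the budget
  set F : ℕ → ℝ := fun l => if (1 ≤ l ∧ (l : ℝ) < T) then ν l * (T - l) else 0 with hF
  clear_value F
  have Fnn : ∀ l ∈ Finset.range (2 * lo + 2 * K + 1), 0 ≤ F l := by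
    intro l _; rw [hF]; dsimp only; split_ifs with hc
    · exact mul_nonneg (g0 l) (by linarith [hc.2])
    · exact le_rfl
  have Fge : ∀ l : ℕ, 1 ≤ l → ν l * (T - l) ≤ F l := by
    intro l hl; rw [hF]; dsimp only; split_ifs with hc
    · exact le_rfl
    · have hle : T ≤ (l : ℝ) := by
        by_contra hlt; push Not at hlt; exact hc ⟨hl, hlt⟩
      exact mul_nonpos_of_nonneg_of_nonpos (g0 l) (by linarith)
  have cB : ((lo + K : ℕ) : ℝ) = (lo : ℝ) + K := by push_cast; ring
  have ch1 : ((2 * lo + K : ℕ) : ℝ) = 2 * (lo : ℝ) + K := by push_cast; ring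
  have ctop : ((2 * lo + 2 * K : ℕ) : ℝ) = 2 * (lo : ℝ) + 2 * K := by push_cast; ring
  have bud3 : ν lo * (T - lo) + ν (lo + K) * max (T - ((lo : ℝ) + K)) 0 + ν (2 * lo + K) * max (T - (2 * (lo : ℝ) + K)) 0
      ≤ ∑ l ∈ Finset.range (2 * lo + 2 * K + 1), F l := by
    have hsub : ({lo, lo + K, 2 * lo + K} : Finset ℕ) ⊆ Finset.range (2 * lo + 2 * K + 1) := by
      intro l hl; simp only [Finset.mem_insert, Finset.mem_singleton] at hl; simp only [Finset.mem_range]; omega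
    have hs := Finset.sum_le_sum_of_subset_of_nonneg hsub (fun l hl _ => Fnn l hl)
    have e : ∑ l ∈ ({lo, lo + K, 2 * lo + K} : Finset ℕ), F l = F lo + (F (lo + K) + F (2 * lo + K)) := by
      have n1 : lo ∉ ({lo + K, 2 * lo + K} : Finset ℕ) := by
        simp only [Finset.mem_insert, Finset.mem_singleton]; omega
      have n2 : lo + K ∉ ({2 * lo + K} : Finset ℕ) := by simp only [Finset.mem_singleton]; omega
      rw [Finset.sum_insert n1, Finset.sum_insert n2, Finset.sum_singleton]
    have f0 := Fge lo hlo
    have f1 : ν (lo + K) * max (T - ((lo : ℝ) + K)) 0 ≤ F (lo + K) := by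
      rcases le_total (T - ((lo : ℝ) + K)) 0 with hle | hle
      · rw [max_eq_right hle, mul_zero]; exact Fnn _ (Finset.mem_range.2 (by omega))
      · rw [max_eq_left hle]; have := Fge (lo + K) (by omega); rw [cB] at this; exact this
    have f2 : ν (2 * lo + K) * max (T - (2 * (lo : ℝ) + K)) 0 ≤ F (2 * lo + K) := by
      rcases le_total (T - (2 * (lo : ℝ) + K)) 0 with hle | hle
      · rw [max_eq_right hle, mul_zero]; exact Fnn _ (Finset.mem_range.2 (by omega))
      · rw [max_eq_left hle]; have := Fge (2 * lo + K) (by omega); rw [ch1] at this; exact this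
    rw [e] at hs; linarith
  have bud0 : 0 ≤ ∑ l ∈ Finset.range (2 * lo + 2 * K + 1), F l := Finset.sum_nonneg Fnn
  -- the two layer-free rates
  have ed1 : (((2 * lo + K : ℕ) : ℝ) - lo) = (lo : ℝ) + K := by push_cast; ring
  have ed2 : (((2 * lo + 2 * K : ℕ) : ℝ) - lo) = (lo : ℝ) + 2 * K := by push_cast; ring
  have eD : T - 2 * (lo : ℝ) = D := by rw [eTD]; ring
  have eθ1 : freeRate y T lo (2 * lo + K) = max y (D / ((lo : ℝ) + K)) / (1 - max y (D / ((lo : ℝ) + K))) := by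
    unfold freeRate; rw [ed1, eD]
  have eθt : freeRate y T lo (2 * lo + 2 * K) = max y (D / ((lo : ℝ) + 2 * K)) / (1 - max y (D / ((lo : ℝ) + 2 * K))) := by
    unfold freeRate; rw [ed2, eD]
  have hρtlt : D / ((lo : ℝ) + 2 * K) < 1 := by
    rw [div_lt_one hL0]; rw [eTD] at hTtop; linarith
  have hθtlt : max y (D / ((lo : ℝ) + 2 * K)) < 1 := max_lt hy1 hρtlt
  have hθt0 : 0 ≤ max y (D / ((lo : ℝ) + 2 * K)) := le_trans hy0.le (le_max_left _ _)
  have hmass : 0 < a * (1 - γ) := mul_pos ha0 nγ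
  by_cases hDB : D < (lo : ℝ) + K
  · -- the near absorber `2lo+K` is compatible
    have hcomp : T < (lo : ℝ) + ((2 * lo + K : ℕ) : ℝ) := by rw [ch1, eTD]; linarith
    have hρ1lt : D / ((lo : ℝ) + K) < 1 := by rw [div_lt_one hB0]; exact hDB
    have hθ1lt : max y (D / ((lo : ℝ) + K)) < 1 := max_lt hy1 hρ1lt
    by_cases hcap : max y (D / ((lo : ℝ) + K)) * (ν lo + ν (2 * lo + K)) ≤ ν (2 * lo + K)
    · -- everything to `2lo+K` (cost-safe)
      refine ⟨ν lo, 0, g0 _, le_rfl, by ring, fun _ => hcomp, ?_, by rw [mul_zero]; exact g0 _, ?_⟩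
      · rw [eθ1]; exact rate_mul_le_of_theta hθ1lt hcap (g0 _)
      · rw [mul_zero, mul_zero, add_zero]
        split_ifs with hfar
        · refine le_trans ?_ (le_trans (Fge lo hlo) (Finset.single_le_sum Fnn (Finset.mem_range.2 (by omega))))
          rw [eθ1]
          refine cost_le_of_theta hθ1lt ?_
          have hs : max y (D / ((lo : ℝ) + K)) * ((((2 * lo + K : ℕ) : ℝ)) - lo) ≤ T - lo := by
            rw [ed1]
            rcases le_total y (D / ((lo : ℝ) + K)) with hle | hle
            · rw [max_eq_right hle, div_mul_cancel₀ _ hB0.ne', eTD]; linarith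
            · rw [max_eq_left hle]
              -- `y(lo+K) ≤ T/2`: `xB ≤ min(lo+Kγ, Bg) ≤ T₀/2`
              have h1 : x * ((lo : ℝ) + K) ≤ ((lo : ℝ) + K) * g := by
                rw [mul_comm ((lo : ℝ) + K) g]; exact mul_le_mul_of_nonneg_right hxg hB0.le
              have h2 : 2 * (x * ((lo : ℝ) + K)) ≤ T₀ := by rw [hT₀]; linarith
              have h3 : a * (2 * (x * ((lo : ℝ) + K))) ≤ a * T₀ := mul_le_mul_of_nonneg_left h2 ha0.le
              have h4 : y * ((lo : ℝ) + K) = a * (x * ((lo : ℝ) + K)) := by rw [hy]; ring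
              rw [h4]; rw [hT] at hT2 ⊢; linarith
          exact pieceBlob_costA hs (g0 lo)
        · exact bud0
    · -- SPLIT: saturate `2lo+K`, overflow to the top
      have hyρ : y ≤ D / ((lo : ℝ) + K) := by
        by_contra hc; push Not at hc
        apply hcap
        rw [max_eq_left hc.le, v1, v3]
        have e : y * (a * ((1 - γ) * (1 - g)) + a * ((1 - γ) * g)) = (a * (1 - γ)) * y := by ring
        rw [e]
        have h1 : (a * (1 - γ)) * y ≤ (a * (1 - γ)) * g := mul_le_mul_of_nonneg_left (le_trans hyx hxg) hmass.le
        linarith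
      have hθ1 : max y (D / ((lo : ℝ) + K)) = D / ((lo : ℝ) + K) := max_eq_right hyρ
      have hDBg : ((lo : ℝ) + K) * g < D := by
        have hc := lt_of_not_ge hcap
        rw [hθ1, v1, v3] at hc
        rw [div_mul_eq_mul_div, lt_div_iff₀ hB0] at hc
        have e1 : a * ((1 - γ) * g) * ((lo : ℝ) + K) = (a * (1 - γ)) * (((lo : ℝ) + K) * g) := by ring
        have e2 : D * (a * ((1 - γ) * (1 - g)) + a * ((1 - γ) * g)) = (a * (1 - γ)) * D := by ring
        rw [e1, e2] at hc
        exact lt_of_mul_lt_mul_left hc hmass.le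
      have hDyB : y * ((lo : ℝ) + K) ≤ D := by rwa [le_div_iff₀ hB0] at hyρ
      set f₁ : ℝ := a * ((1 - γ) * g) * (((lo : ℝ) + K) - D) / D with hf₁
      set f₂ : ℝ := a * (1 - γ) * (D - ((lo : ℝ) + K) * g) / D with hf₂
      have hf₁0 : 0 ≤ f₁ := by
        rw [hf₁]; exact div_nonneg (mul_nonneg (mul_nonneg ha0.le (mul_nonneg nγ.le pg)) (by linarith)) hD0.le
      have hf₂0 : 0 ≤ f₂ := by rw [hf₂]; exact div_nonneg (mul_nonneg hmass.le (by linarith)) hD0.le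
      have hsum : f₁ + f₂ = ν lo := by
        rw [hf₁, hf₂, v1]
        have := pb_split_sum (B := (lo : ℝ) + K) (c := a * (1 - γ)) (g := g) hD0
        have e : a * ((1 - γ) * g) * ((lo : ℝ) + K - D) / D = a * (1 - γ) * g * ((lo : ℝ) + K - D) / D := by ring
        rw [e, this]; ring
      have hsat : freeRate y T lo (2 * lo + K) * f₁ = ν (2 * lo + K) := by
        rw [eθ1, hθ1, hf₁, v3]
        have := pb_rate_sat (c := a * ((1 - γ) * g)) hB0 hD0 hDB
        rw [this]
      refine ⟨f₁, f₂, hf₁0, hf₂0, hsum, fun _ => hcomp, le_of_eq hsat, ?_, ?_⟩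
      · -- capacity of the top for the overflow
        rw [eθt]
        refine rate_mul_le_of_theta hθtlt ?_ hf₂0
        rw [max_mul_of_nonneg _ _ (add_nonneg hf₂0 (g0 _)), v4]
        refine max_le ?_ ?_
        · -- floor part: brick PB2
          have hb := pb_PB2 (lo : ℝ) K γ g D y hlo0 hKR.le hK4R hγ hγ1.le hbig hg1.le hD0.le hDBg.le hDB.le hDmax hy0.le hy1.le hDyB
            hyg' hyB'
          rw [hf₂]
          have e : y * (a * (1 - γ) * (D - ((lo : ℝ) + K) * g) / D + a * (γ * g))
              = (a / D) * (y * (1 - γ) * (D - ((lo : ℝ) + K) * g) + y * (γ * g * D)) := by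
            field_simp
          have e2 : a * (γ * g) = (a / D) * (γ * g * D) := by field_simp
          rw [e, e2]
          exact mul_le_mul_of_nonneg_left (by linarith [hb]) (div_nonneg ha0.le hD0.le)
        · -- ρ part: brick PB1 with `D ≤ D_max`
          have hb := pb_PB1 (lo : ℝ) K γ g hlo0 hKR.le hK4R hγ hγ1.le hbig hg1.le
          rw [hf₂, div_mul_eq_mul_div, div_le_iff₀ hL0]
          have e : D * (a * (1 - γ) * (D - ((lo : ℝ) + K) * g) / D + a * (γ * g))
              = a * ((1 - γ) * (D - ((lo : ℝ) + K) * g) + γ * g * D) := by field_simp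
          rw [e]
          have hmono : D * ((1 - γ) + γ * g) ≤ (K * γ - lo + ((lo : ℝ) + K) * g) * ((1 - γ) + γ * g) :=
            mul_le_mul_of_nonneg_right hDmax (add_nonneg nγ.le (mul_nonneg pγ pg))
          have key : (1 - γ) * (D - ((lo : ℝ) + K) * g) + γ * g * D ≤ ((lo : ℝ) + 2 * K) * (γ * g) := by linarith [hb, hmono]
          have key2 := mul_le_mul_of_nonneg_left key ha0.le
          linarith [key2]
      · -- joint torque cost
        rw [hsat]
        refine le_trans ?_ bud3
        rw [v1, v2, v3, eθt, hf₂]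
        rcases le_total y (D / ((lo : ℝ) + 2 * K)) with hle | hle
        · -- `θ_t = D/L`: bricks PC1a / PC1b / PC1c (× (L − D))
          rw [max_eq_right hle, pb_rate_top (c := a * (1 - γ)) hL0 hD0 (lt_trans hDB (by linarith))]
          have hLD : 0 < (lo : ℝ) + 2 * K - D := by linarith
          rw [ch1, ctop]
          by_cases hTB : T < (lo : ℝ) + K
          · have hb := pb_PC1a (lo : ℝ) K γ g D hlo0 hKR.le hK4R hγ hγ1.le hbig hg1.le hD0.le hDBg.le hDB.le hDmax (by rw [eTD] at hTB; linarith)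
            rw [if_pos (by rw [eTD] at hTB ⊢; linarith), max_eq_right (by linarith), max_eq_right (by rw [eTD] at hTB ⊢; linarith), mul_zero,
              mul_zero, add_zero, add_zero]
            rw [eTD]
            have e1 : (2 * (lo : ℝ) + K - (2 * lo + D)) * (a * ((1 - γ) * g)) + (2 * (lo : ℝ) + 2 * K - (2 * lo + D)) * (a * (1 - γ) * (D - ((lo : ℝ) + K) * g) / ((lo : ℝ) + 2 * K - D))
                = (a / ((lo : ℝ) + 2 * K - D)) * ((K - D) * ((1 - γ) * g) * ((lo : ℝ) + 2 * K - D) + (2 * K - D) * (1 - γ) * (D - ((lo : ℝ) + K) * g)) := by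
              field_simp; ring
            have e2 : a * ((1 - γ) * (1 - g)) * (2 * lo + D - lo) = (a / ((lo : ℝ) + 2 * K - D)) * (((lo : ℝ) + 2 * K - D) * ((1 - γ) * (1 - g) * (lo + D))) := by
              field_simp; ring
            rw [e1, e2]
            exact mul_le_mul_of_nonneg_left hb (div_nonneg ha0.le hLD.le)
          · push Not at hTB
            by_cases hTh : T < 2 * (lo : ℝ) + K
            · have hb := pb_PC1b (lo : ℝ) K γ g D hlo0 hKR.le hK4R hγ hγ1.le hbig hg1.le hD0.le hDBg.le hDB.le hDmax (by rw [eTD] at hTB; linarith)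
                (by rw [eTD] at hTh; linarith)
              rw [if_pos hTh, max_eq_left (by linarith), max_eq_right (by linarith), mul_zero, add_zero]
              rw [eTD]
              have e1 : (2 * (lo : ℝ) + K - (2 * lo + D)) * (a * ((1 - γ) * g)) + (2 * (lo : ℝ) + 2 * K - (2 * lo + D)) * (a * (1 - γ) * (D - ((lo : ℝ) + K) * g) / ((lo : ℝ) + 2 * K - D))
                  = (a / ((lo : ℝ) + 2 * K - D)) * ((K - D) * ((1 - γ) * g) * ((lo : ℝ) + 2 * K - D) + (2 * K - D) * (1 - γ) * (D - ((lo : ℝ) + K) * g)) := by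
                field_simp; ring
              have e2 : a * ((1 - γ) * (1 - g)) * (2 * lo + D - lo) + a * (γ * (1 - g)) * (2 * lo + D - ((lo : ℝ) + K))
                  = (a / ((lo : ℝ) + 2 * K - D)) * (((lo : ℝ) + 2 * K - D) * ((1 - γ) * (1 - g) * (lo + D) + γ * (1 - g) * (lo + D - K))) := by
                field_simp; ring
              rw [e1, e2]
              exact mul_le_mul_of_nonneg_left hb (div_nonneg ha0.le hLD.le)
            · push Not at hTh
              have hb := pb_PC1c (lo : ℝ) K γ g D hlo0 hKR.le hK4R hγ hγ1.le hbig hg1.le hD0.le hDBg.le hDB.le hDmax (by rw [eTD] at hTh; linarith)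
              rw [if_neg (not_lt.2 hTh), max_eq_left (by linarith), max_eq_left (by linarith), zero_add]
              rw [eTD]
              have e1 : (2 * (lo : ℝ) + 2 * K - (2 * lo + D)) * (a * (1 - γ) * (D - ((lo : ℝ) + K) * g) / ((lo : ℝ) + 2 * K - D))
                  = (a / ((lo : ℝ) + 2 * K - D)) * ((2 * K - D) * (1 - γ) * (D - ((lo : ℝ) + K) * g)) := by
                field_simp; ring
              have e2 : a * ((1 - γ) * (1 - g)) * (2 * lo + D - lo) + a * (γ * (1 - g)) * (2 * lo + D - ((lo : ℝ) + K)) + a * ((1 - γ) * g) * (2 * lo + D - (2 * (lo : ℝ) + K))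
                  = (a / ((lo : ℝ) + 2 * K - D)) * (((lo : ℝ) + 2 * K - D) * ((1 - γ) * (1 - g) * (lo + D) + γ * (1 - g) * (lo + D - K) + (1 - γ) * g * (D - K))) := by
                field_simp; ring
              rw [e1, e2]
              exact mul_le_mul_of_nonneg_left hb (div_nonneg ha0.le hLD.le)
        · -- `θ_t = y`: bricks PC2a / PC2b / PC2c (× D(1 − y))
          rw [max_eq_left hle]
          have hyL : D ≤ y * ((lo : ℝ) + 2 * K) := by rwa [div_le_iff₀ hL0] at hle
          have h1y : 0 < 1 - y := by linarith
          have ert : y / (1 - y) * (a * (1 - γ) * (D - ((lo : ℝ) + K) * g) / D) = (a / (D * (1 - y))) * (y * (1 - γ) * (D - ((lo : ℝ) + K) * g)) := by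
            field_simp
          rw [ert, ch1, ctop]
          have hpos : 0 ≤ a / (D * (1 - y)) := div_nonneg ha0.le (mul_pos hD0 h1y).le
          by_cases hTB : T < (lo : ℝ) + K
          · have hb := pb_PC2a (lo : ℝ) K γ g D y hlo0 hKR.le hK4R hγ hγ1 hbig hg1 hD0.le hDBg.le hDB.le hDmax (by rw [eTD] at hTB; linarith)
              hy0.le hy1.le hDyB hyL hyg' hyB'
            rw [if_pos (by rw [eTD] at hTB ⊢; linarith), max_eq_right (by linarith), max_eq_right (by rw [eTD] at hTB ⊢; linarith), mul_zero,
              mul_zero, add_zero, add_zero]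
            rw [eTD]
            have e1 : (2 * (lo : ℝ) + K - (2 * lo + D)) * (a * ((1 - γ) * g)) + (2 * (lo : ℝ) + 2 * K - (2 * lo + D)) * (a / (D * (1 - y)) * (y * (1 - γ) * (D - ((lo : ℝ) + K) * g)))
                = (a / (D * (1 - y))) * ((K - D) * ((1 - γ) * g) * D * (1 - y) + (2 * K - D) * y * (1 - γ) * (D - ((lo : ℝ) + K) * g)) := by
              field_simp; ring
            have e2 : a * ((1 - γ) * (1 - g)) * (2 * lo + D - lo) = (a / (D * (1 - y))) * ((1 - γ) * (1 - g) * (lo + D) * D * (1 - y)) := by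
              field_simp; ring
            rw [e1, e2]
            exact mul_le_mul_of_nonneg_left hb hpos
          · push Not at hTB
            by_cases hTh : T < 2 * (lo : ℝ) + K
            · have hb := pb_PC2b (lo : ℝ) K γ g D y hlo0 hKR.le hK4R hγ hγ1 hbig hg1 hD0.le hDBg.le hDB.le hDmax (by rw [eTD] at hTB; linarith)
                (by rw [eTD] at hTh; linarith) hy0.le hy1.le hDyB hyL hyg' hyB'
              rw [if_pos hTh, max_eq_left (by linarith), max_eq_right (by linarith), mul_zero, add_zero]
              rw [eTD]
              have e1 : (2 * (lo : ℝ) + K - (2 * lo + D)) * (a * ((1 - γ) * g)) + (2 * (lo : ℝ) + 2 * K - (2 * lo + D)) * (a / (D * (1 - y)) * (y * (1 - γ) * (D - ((lo : ℝ) + K) * g)))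
                  = (a / (D * (1 - y))) * ((K - D) * ((1 - γ) * g) * D * (1 - y) + (2 * K - D) * y * (1 - γ) * (D - ((lo : ℝ) + K) * g)) := by
                field_simp; ring
              have e2 : a * ((1 - γ) * (1 - g)) * (2 * lo + D - lo) + a * (γ * (1 - g)) * (2 * lo + D - ((lo : ℝ) + K))
                  = (a / (D * (1 - y))) * (((1 - γ) * (1 - g) * (lo + D) + γ * (1 - g) * (lo + D - K)) * D * (1 - y)) := by
                field_simp; ring
              rw [e1, e2]
              exact mul_le_mul_of_nonneg_left hb hpos
            · push Not at hTh
              have hb := pb_PC2c (lo : ℝ) K γ g D y hlo0 hKR.le hK4R hγ hγ1 hbig hg1 hD0.le hDBg.le hDB.le hDmax (by rw [eTD] at hTh; linarith)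
                hy0.le hy1.le hDyB hyL hyg' hyB'
              rw [if_neg (not_lt.2 hTh), max_eq_left (by linarith), max_eq_left (by linarith), zero_add]
              rw [eTD]
              have e1 : (2 * (lo : ℝ) + 2 * K - (2 * lo + D)) * (a / (D * (1 - y)) * (y * (1 - γ) * (D - ((lo : ℝ) + K) * g)))
                  = (a / (D * (1 - y))) * ((2 * K - D) * y * (1 - γ) * (D - ((lo : ℝ) + K) * g)) := by
                field_simp; ring
              have e2 : a * ((1 - γ) * (1 - g)) * (2 * lo + D - lo) + a * (γ * (1 - g)) * (2 * lo + D - ((lo : ℝ) + K)) + a * ((1 - γ) * g) * (2 * lo + D - (2 * (lo : ℝ) + K))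
                  = (a / (D * (1 - y))) * (((1 - γ) * (1 - g) * (lo + D) + γ * (1 - g) * (lo + D - K) + (1 - γ) * g * (D - K)) * D * (1 - y)) := by
                field_simp; ring
              rw [e1, e2]
              exact mul_le_mul_of_nonneg_left hb hpos
  · -- the near absorber is incompatible (`D ≥ lo+K`): everything to the top
    push Not at hDB
    have hT3 : (lo : ℝ) + K + 2 * lo ≤ T := by rw [eTD]; linarith
    refine ⟨0, ν lo, le_rfl, g0 _, by ring, fun h => absurd h (lt_irrefl _), by rw [mul_zero]; exact g0 _, ?_, ?_⟩
    · -- capacity of the top for the whole low: bricks PD1 / PD2x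
      rw [eθt]
      refine rate_mul_le_of_theta hθtlt ?_ (g0 _)
      rw [max_mul_of_nonneg _ _ (add_nonneg (g0 _) (g0 _)), v1, v4]
      refine max_le ?_ ?_
      · have hb := pb_PD2x (lo : ℝ) K γ g x hlo0 hKR.le hK4R hγ hγ1.le hbig hg1.le hx0.le hxg (by linarith [hxP]) (le_trans hDB hDmax)
        have h1 : y * (a * ((1 - γ) * (1 - g)) + a * (γ * g)) ≤ x * (a * ((1 - γ) * (1 - g)) + a * (γ * g)) :=
          mul_le_mul_of_nonneg_right hyx (add_nonneg (mul_nonneg ha0.le (mul_nonneg nγ.le ng.le)) (mul_nonneg ha0.le (mul_nonneg pγ pg)))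
        have h2 : x * (a * ((1 - γ) * (1 - g)) + a * (γ * g)) = a * (x * ((1 - γ) * (1 - g) + γ * g)) := by ring
        have h3 := mul_le_mul_of_nonneg_left hb ha0.le
        linarith [h1, h2, h3]
      · have hb := pb_PD1 (lo : ℝ) K γ g D hlo0 hKR.le hK4R hγ hγ1.le hbig hg1.le hDB hDmax
        rw [div_mul_eq_mul_div, div_le_iff₀ hL0]
        have h3 := mul_le_mul_of_nonneg_left hb ha0.le
        have e1 : D * (a * ((1 - γ) * (1 - g)) + a * (γ * g)) = a * (D * ((1 - γ) * (1 - g) + γ * g)) := by ring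
        have e2 : a * (γ * g) * ((lo : ℝ) + 2 * K) = a * (((lo : ℝ) + 2 * K) * (γ * g)) := by ring
        rw [e1, e2]; exact h3
    · -- torque cost of the top route: bricks PE1 / PE2
      rw [mul_zero, mul_zero]
      simp only [ite_self, zero_add]
      refine le_trans ?_ bud3
      rw [max_eq_left (by linarith), max_eq_left (by linarith), v1, v2, v3, eθt, ctop]
      rcases le_total y (D / ((lo : ℝ) + 2 * K)) with hle | hle
      · rw [max_eq_right hle]
        have hb := pb_PE1 (lo : ℝ) K γ g D hlo0 hKR.le hK4R hγ hγ1.le hbig hg1.le hDB hDmax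
        have hLD : 0 < (lo : ℝ) + 2 * K - D := by rw [eTD] at hTtop; linarith
        rw [eTD]
        have e1 : (2 * (lo : ℝ) + 2 * K - (2 * lo + D)) * (D / ((lo : ℝ) + 2 * K) / (1 - D / ((lo : ℝ) + 2 * K)) * (a * ((1 - γ) * (1 - g))))
            = (a / ((lo : ℝ) + 2 * K - D)) * ((2 * K - D) * D * ((1 - γ) * (1 - g))) := by
          have hL : ((lo : ℝ) + 2 * K) ≠ 0 := hL0.ne'
          have hLD' : ((lo : ℝ) + 2 * K - D) ≠ 0 := hLD.ne'
          field_simp; ring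
        have e2 : a * ((1 - γ) * (1 - g)) * (2 * lo + D - lo) + a * (γ * (1 - g)) * (2 * lo + D - ((lo : ℝ) + K)) + a * ((1 - γ) * g) * (2 * lo + D - (2 * (lo : ℝ) + K))
            = (a / ((lo : ℝ) + 2 * K - D)) * (((lo : ℝ) + 2 * K - D) * ((1 - γ) * (1 - g) * (lo + D) + γ * (1 - g) * (lo + D - K) + (1 - γ) * g * (D - K))) := by
          field_simp; ring
        rw [e1, e2]
        exact mul_le_mul_of_nonneg_left hb (div_nonneg ha0.le hLD.le)
      · rw [max_eq_left hle]
        have hyL : D ≤ y * ((lo : ℝ) + 2 * K) := by rwa [div_le_iff₀ hL0] at hle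
        have hb := pb_PE2 (lo : ℝ) K γ g D y hlo0 hKR.le hK4R hγ hγ1.le hbig hg1.le hDB hDmax hy0.le hy1.le hyL hyg' hyB'
        have h1y : 0 < 1 - y := by linarith
        rw [eTD]
        have e1 : (2 * (lo : ℝ) + 2 * K - (2 * lo + D)) * (y / (1 - y) * (a * ((1 - γ) * (1 - g))))
            = (a / (1 - y)) * ((2 * K - D) * y * ((1 - γ) * (1 - g))) := by
          have : (1 - y) ≠ 0 := h1y.ne'
          field_simp; ring
        have e2 : a * ((1 - γ) * (1 - g)) * (2 * lo + D - lo) + a * (γ * (1 - g)) * (2 * lo + D - ((lo : ℝ) + K)) + a * ((1 - γ) * g) * (2 * lo + D - (2 * (lo : ℝ) + K))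
            = (a / (1 - y)) * ((1 - y) * ((1 - γ) * (1 - g) * (lo + D) + γ * (1 - g) * (lo + D - K) + (1 - γ) * g * (D - K))) := by
          have : (1 - y) ≠ 0 := h1y.ne'
          field_simp; ring
        rw [e1, e2]
        exact mul_le_mul_of_nonneg_left hb (div_nonneg ha0.le h1y.le)

end LawDec
end Quant
end Summit.CriticalPhenomena.PercolationContinuityZ3.Theorems
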